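import Summits.Ventures.HodgeRepro.Tier3WeilLineKunneth

/-!
# The eigen-decomposition of the Künneth component — §4(a)'s «`K ⊗ ℂ = ⊕_χ K_χ`» on the kernel

Blind re-derivation cell `pub-hodge-repro`, seat `t3-p4` (Tier 3, T3.5 for T3.4 = Lemma R).  Target tree path
`lean/Summits/Ventures/HodgeRepro/Tier3KunnethEigenDecomposition.lean`; imports the cell's `Tier3WeilLineKunneth`
(the Künneth component stated without a definition, `constr_update_zero_one_apply`,
`symm_ιMulti_mem_baseChange_kunneth_of_corner`; transitively `lineSet`, `exists_perm_eq_comp_of_image_eq`).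

WHAT THIS FILE STATES (LEMMA-R-RESIDUE.md §4(a): «`H¹(A_{T_i}) ⊗ ℂ = ⊕_{σ∈S} ℓ^{(i)}_σ` with `ℓ^{(i)}_σ` a LINE on
which `a ∈ F` acts as `σ(a)`; so `K ⊗ ℂ = ⊕_{χ ∈ S^{2p}} K_χ`, `K_χ := ⊗_i ℓ^{(i)}_{χ_i}`, and `a_1 ⊗ ⋯ ⊗ a_{2p} ∈ R`
acts on `K_χ` by `∏_i χ_i(a_i)`»).  On the kernel `V = H¹(B, ℚ)` is a `K`-space with `K`-basis `ω′ : ι → V` (one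
generator per corner; `K = F`, `F₀ = ℚ`, `n = |ι| = 2p`), `e′ : ι × Gal(K/F₀) → K ⊗[F₀] V` is the eigenbasis with the
diagonal eigen-relation `(1 ⊗ A′ b) e′(i, σ) = σ(bᵢ) • e′(i, σ)` (`e′(i, σ)` spans the line `ℓ^{(i)}_σ`), `Φ′` is the
base change of the wedge space, and the Künneth component `K_{Künneth} ⊂ ⋀[F₀]^n V` is the `F₀`-span of the wedges with
exactly one vector from each corner (`Tier3WeilLineKunneth`).  A CHARACTER `χ : ι → Gal` picks one eigenline per corner,
and `K_χ` is the `K`-line through the wedge `∧_t e′(f t, χ(f t))` (`f : Fin n → ι` a bijective enumeration of the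
corners; the ordering only changes a sign, which a span absorbs).

* `symm_ιMulti_eigen_mem_baseChange_kunneth` — every `χ`-line wedge lies in `K_{Künneth} ⊗ K` (each `e′(i, σ)` is a
  corner vector of `i`: the eigen-relation at the indicator vector of `i` reads `σ(1) • e′(i, σ)`);
* `baseChange_kunneth_le_span_eigenWedge` — **the converse**: `K_{Künneth} ⊗ K` lies in the `K`-span of the `χ`-line
  wedges.  The `K`-multilinear map `(y₁, …, yₙ) ↦ Φ′⁻¹ ((1 ⊗ P₁) y₁ ∧ ⋯ ∧ (1 ⊗ Pₙ) yₙ)` (`Pₜ` the corner projection of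
  `f t`) takes every value in that span: on the eigenbasis vectors `e′(v t)` the slot `t` is `e′(v t)` if `(v t).1 = f t`
  and `0` otherwise (`Module.Basis.ext_multilinear` on `e′` against the quotient by the span), and at
  `yₜ = 1 ⊗ (cₜ • ω′_{f t})` the map returns `1 ⊗ (∧_t cₜ ω′_{f t})`;
* `baseChange_kunneth_eq_span_eigenWedge` — **§4(a)'s `K ⊗ ℂ = ⊕_χ K_χ`**: `K_{Künneth} ⊗ K = span_K {χ-line wedges}`;
* `baseChange_kunneth_eq_span_graph` — the same with the `χ`-lines read in the wedge BASIS `E′` (so the sum is direct):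
  `K_{Künneth} ⊗ K = span_K {E′_L : L the graph {(i, χ i)} of some χ}` (`exists_perm_eq_comp_of_image_eq` +
  `AlternatingMap.map_perm` for the sign between an enumeration and the increasing one);
* `map_baseChange_diag_ιMulti_eigen` — **«`a_1 ⊗ ⋯ ⊗ a_{2p}` acts on `K_χ` by `∏_i χ_i(a_i)`»**: `⋀ⁿ(1 ⊗ A′ b)` multiplies
  the `χ`-line wedge by `∏_i χ i (b i)`;
* `weil_line_baseChange_le_baseChange_kunneth` — §4(b)'s «`W_F(B) ⊗ ℂ = ⊕_σ K_{(σ,…,σ)} ⊂ K ⊗ ℂ`» by statement: the lines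
  `L_σ` are the graphs of the constant characters, so `W_F ⊗ K = span{E′_{L_σ}} ≤ K_{Künneth} ⊗ K`.

HONESTY.  `Tier3WeilLineKunneth` proved the ONE inclusion Lemma R needs (`W_F ⊂ K`); this file is the LABEL for the
decomposition sentence of §4(a) itself — the equality `K ⊗ ℂ = ⊕_χ K_χ`, whose second half (`⊆`) was on paper — and for
the eigenvalue of a pure tensor of `R` on `K_χ`.  No consumer of the lane needs it; the `R`-action itself is not built
(the no-definition rule of the cell).  Linear algebra on the cell's own modules and Mathlib; no definition, instance or
notation is introduced; nothing geometric is built.  Nothing mathematical moves (LEMMA-R-RESIDUE: residue 0 unchanged).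
HC_CM is NOT proved by anyone in this repository.
-/

set_option autoImplicit false

open TensorProduct Finset

namespace HodgeRepro.Tier3

open HodgeRepro.RouteC

/-! ### §1 The `χ`-line wedges lie in the base change of the Künneth component -/

section EigenWedge

variable {F₀ K : Type*} [Field F₀] [Field K] [Algebra F₀ K]
variable {V : Type*} [AddCommGroup V] [Module K V] [Module F₀ V] [IsScalarTower F₀ K V]
variable {ι : Type*} [DecidableEq ι]

/-- **A `χ`-line wedge lies in `K_{Künneth} ⊗ K`**: for a bijective enumeration `f` of the corners and a character
`χ : ι → Gal`, `Φ′⁻¹ (∧_t e′(f t, χ (f t)))` lies in the base change of the Künneth span — each `e′(i, σ)` is fixed by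
the corner projection of `i` (the eigen-relation at the indicator vector of `i`: `σ(1) = 1`), so
`symm_ιMulti_mem_baseChange_kunneth_of_corner` applies. -/
theorem symm_ιMulti_eigen_mem_baseChange_kunneth {n : ℕ} (ω' : Module.Basis ι K V)
    (e' : Module.Basis (ι × (K ≃ₐ[F₀] K)) K (K ⊗[F₀] V))
    (Φ' : K ⊗[F₀] ⋀[F₀]^n V ≃ₗ[K] ⋀[K]^n (K ⊗[F₀] V))
    (he2' : ∀ (x : K ≃ₐ[F₀] K) (i : ι) (b : ι → K),
      LinearMap.lTensor K ((ω'.constr K fun i => b i • ω' i).restrictScalars F₀) (e' (i, x)) =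
        x (b i) • e' (i, x))
    (hΦ' : ∀ (c : K) (w : Fin n → V),
      Φ' (c ⊗ₜ[F₀] exteriorPower.ιMulti F₀ n w) = c • exteriorPower.ιMulti K n (fun i => (1 : K) ⊗ₜ[F₀] w i))
    (f : Fin n → ι) (hf : Function.Bijective f) (χ : ι → (K ≃ₐ[F₀] K)) :
    Φ'.symm (exteriorPower.ιMulti K n (fun t => e' (f t, χ (f t)))) ∈
      (Submodule.span F₀ {w : ⋀[F₀]^n V | ∃ (c : Fin n → K) (e : Fin n → ι), Function.Bijective e ∧
        w = exteriorPower.ιMulti F₀ n (fun t => c t • ω' (e t))}).baseChange K := by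
  classical
  have hx : ∀ t, LinearMap.lTensor K
      ((ω'.constr K fun j => Function.update (fun _ => (0 : K)) (f t) (1 : K) j • ω' j).restrictScalars F₀)
        (e' (f t, χ (f t))) = e' (f t, χ (f t)) := by
    intro t
    rw [he2' (χ (f t)) (f t) (Function.update (fun _ => (0 : K)) (f t) (1 : K)), Function.update_self, map_one,
      one_smul]
  have hmem := symm_ιMulti_mem_baseChange_kunneth_of_corner n ω' Φ' hΦ' f (fun t => e' (f t, χ (f t))) hx
  refine Submodule.baseChange_mono K (Submodule.span_mono ?_) hmem
  rintro _ ⟨c, rfl⟩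
  exact ⟨c, f, hf, rfl⟩

/-- **The corner projection on an eigenbasis vector**: `(1 ⊗ A′ (1 at i, 0 elsewhere)) e′(i′, σ)` is `e′(i′, σ)` if
`i′ = i` and `0` otherwise (the eigen-relation: `σ(1) = 1`, `σ(0) = 0`). -/
theorem lTensor_corner_eigen (ω' : Module.Basis ι K V)
    (e' : Module.Basis (ι × (K ≃ₐ[F₀] K)) K (K ⊗[F₀] V))
    (he2' : ∀ (x : K ≃ₐ[F₀] K) (i : ι) (b : ι → K),
      LinearMap.lTensor K ((ω'.constr K fun i => b i • ω' i).restrictScalars F₀) (e' (i, x)) =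
        x (b i) • e' (i, x))
    (i : ι) (p : ι × (K ≃ₐ[F₀] K)) :
    LinearMap.lTensor K
        ((ω'.constr K fun j => Function.update (fun _ => (0 : K)) i (1 : K) j • ω' j).restrictScalars F₀) (e' p) =
      if p.1 = i then e' p else 0 := by
  obtain ⟨i', σ⟩ := p
  rw [he2' σ i' (Function.update (fun _ => (0 : K)) i (1 : K))]
  by_cases h : i' = i
  · subst h
    simp only [Function.update_self, map_one, one_smul, if_true]
  · simp only [Function.update_of_ne h, map_zero, zero_smul, h, if_false]

/-- **`K_{Künneth} ⊗ K` lies in the `K`-span of the `χ`-line wedges** — the half of §4(a)'s «`K ⊗ ℂ = ⊕_χ K_χ`» that was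
on paper.  The `K`-multilinear map `(y₁, …, yₙ) ↦ Φ′⁻¹ ((1 ⊗ P₁) y₁ ∧ ⋯ ∧ (1 ⊗ Pₙ) yₙ)`, `Pₜ` the corner projection of
`f t`, takes every value in the span: on the eigenbasis vectors `y t = e′(v t)` every slot is `e′(v t)` or `0`
(`lTensor_corner_eigen`), so the wedge is a `χ`-line wedge (`χ (f t) := (v t).2`) or `0`
(`Module.Basis.ext_multilinear` on `e′` against the quotient by the span); at `y t = 1 ⊗ (c t • ω′_{f t})` the corner
projections act trivially and the map returns `1 ⊗ (∧_t c t • ω′_{f t})` (`constr_update_zero_one_apply`, `hΦ′`). -/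
theorem baseChange_kunneth_le_span_eigenWedge {n : ℕ} (ω' : Module.Basis ι K V)
    (e' : Module.Basis (ι × (K ≃ₐ[F₀] K)) K (K ⊗[F₀] V))
    (Φ' : K ⊗[F₀] ⋀[F₀]^n V ≃ₗ[K] ⋀[K]^n (K ⊗[F₀] V))
    (he2' : ∀ (x : K ≃ₐ[F₀] K) (i : ι) (b : ι → K),
      LinearMap.lTensor K ((ω'.constr K fun i => b i • ω' i).restrictScalars F₀) (e' (i, x)) =
        x (b i) • e' (i, x))
    (hΦ' : ∀ (c : K) (w : Fin n → V),
      Φ' (c ⊗ₜ[F₀] exteriorPower.ιMulti F₀ n w) = c • exteriorPower.ιMulti K n (fun i => (1 : K) ⊗ₜ[F₀] w i)) :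
    (Submodule.span F₀ {w : ⋀[F₀]^n V | ∃ (c : Fin n → K) (e : Fin n → ι), Function.Bijective e ∧
        w = exteriorPower.ιMulti F₀ n (fun t => c t • ω' (e t))}).baseChange K ≤
      Submodule.span K {z : K ⊗[F₀] ⋀[F₀]^n V | ∃ (f : Fin n → ι) (χ : ι → (K ≃ₐ[F₀] K)),
        Function.Bijective f ∧ z = Φ'.symm (exteriorPower.ιMulti K n (fun t => e' (f t, χ (f t))))} := by
  classical
  set S : Submodule K (K ⊗[F₀] ⋀[F₀]^n V) :=
    Submodule.span K {z : K ⊗[F₀] ⋀[F₀]^n V | ∃ (f : Fin n → ι) (χ : ι → (K ≃ₐ[F₀] K)),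
      Function.Bijective f ∧ z = Φ'.symm (exteriorPower.ιMulti K n (fun t => e' (f t, χ (f t))))} with hS
  rw [Submodule.baseChange_span, Submodule.span_le]
  rintro _ ⟨w, ⟨c, f, hf, rfl⟩, rfl⟩
  rw [SetLike.mem_coe, TensorProduct.mk_apply]
  -- the corner projections `P t` of the corners `f t`
  set P : Fin n → (V →ₗ[F₀] V) := fun t =>
    (ω'.constr K fun j => Function.update (fun _ => (0 : K)) (f t) (1 : K) j • ω' j).restrictScalars F₀ with hP
  -- the `K`-multilinear map `(y₁, …, yₙ) ↦ Φ′⁻¹ ((1 ⊗ P₁) y₁ ∧ ⋯ ∧ (1 ⊗ Pₙ) yₙ)`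
  let h : MultilinearMap K (fun _ : Fin n => K ⊗[F₀] V) (K ⊗[F₀] ⋀[F₀]^n V) :=
    Φ'.symm.toLinearMap.compMultilinearMap
      ((exteriorPower.ιMulti K n).toMultilinearMap.compLinearMap (fun t => (P t).baseChange K))
  have hS_all : ∀ y : Fin n → K ⊗[F₀] V, h y ∈ S := by
    have hzero : S.mkQ.compMultilinearMap h = 0 := by
      refine Module.Basis.ext_multilinear (fun _ => e') fun v => ?_
      simp only [h, LinearMap.compMultilinearMap_apply, MultilinearMap.compLinearMap_apply,
        AlternatingMap.coe_multilinearMap, LinearEquiv.coe_coe, Submodule.mkQ_apply, zero_apply,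
        Submodule.Quotient.mk_eq_zero]
      have hslot : ∀ t, (P t).baseChange K (e' (v t)) = if (v t).1 = f t then e' (v t) else 0 := by
        intro t
        rw [LinearMap.baseChange_eq_ltensor, hP]
        exact lTensor_corner_eigen ω' e' he2' (f t) (v t)
      by_cases hall : ∀ t, (v t).1 = f t
      · -- every slot is an eigenvector of its corner: a `χ`-line wedge with `χ (f t) := (v t).2`
        set g : ι → Fin n := Function.surjInv hf.surjective with hg
        have hgf : ∀ t, g (f t) = t := fun t => hf.injective (Function.surjInv_eq hf.surjective (f t))
        have hvt : ∀ t, v t = (f t, (v (g (f t))).2) := by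
          intro t
          rw [hgf t]
          exact Prod.ext (hall t) rfl
        have hwedge : (fun t => (P t).baseChange K (e' (v t))) =
            fun t => e' (f t, (fun i => (v (g i)).2) (f t)) := by
          funext t
          rw [hslot t, if_pos (hall t)]
          exact congrArg e' (hvt t)
        rw [hwedge]
        exact Submodule.subset_span ⟨f, fun i => (v (g i)).2, hf, rfl⟩
      · -- some slot is killed by its corner projection: the wedge is `0`
        obtain ⟨t₀, ht₀⟩ := not_forall.mp hall
        have h0 : (P t₀).baseChange K (e' (v t₀)) = 0 := by
          rw [hslot t₀, if_neg ht₀]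
        rw [AlternatingMap.map_coord_zero _ t₀ h0, map_zero]
        exact S.zero_mem
    intro y
    have hy := MultilinearMap.congr_fun hzero y
    rw [LinearMap.compMultilinearMap_apply, zero_apply, Submodule.mkQ_apply,
      Submodule.Quotient.mk_eq_zero] at hy
    exact hy
  -- at `y t = 1 ⊗ (c t • ω′_{f t})` the map returns `1 ⊗ w`
  have hfix : ∀ t, P t (c t • ω' (f t)) = c t • ω' (f t) := by
    intro t
    simp only [hP, LinearMap.coe_restrictScalars]
    rw [constr_update_zero_one_apply ω' (f t) (c t • ω' (f t)), LinearEquiv.map_smul, Module.Basis.repr_self,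
      Finsupp.smul_apply, Finsupp.single_eq_same, smul_eq_mul, mul_one]
  have hh : h (fun t => (1 : K) ⊗ₜ[F₀] (c t • ω' (f t))) =
      (1 : K) ⊗ₜ[F₀] exteriorPower.ιMulti F₀ n (fun t => c t • ω' (f t)) := by
    simp only [h, LinearMap.compMultilinearMap_apply, MultilinearMap.compLinearMap_apply,
      AlternatingMap.coe_multilinearMap, LinearEquiv.coe_coe, LinearMap.baseChange_tmul]
    simp only [hfix]
    rw [← LinearEquiv.symm_apply_apply Φ' ((1 : K) ⊗ₜ[F₀] exteriorPower.ιMulti F₀ n (fun t => c t • ω' (f t))),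
      hΦ', one_smul]
  rw [← hh]
  exact hS_all _

/-- **§4(a): `K ⊗ ℂ = ⊕_χ K_χ`** — the base change of the Künneth component is exactly the `K`-span of the `χ`-line
wedges `Φ′⁻¹ (∧_t e′(f t, χ (f t)))`, `χ : ι → Gal` a character (one eigenline per corner), `f` a bijective enumeration
of the corners. -/
theorem baseChange_kunneth_eq_span_eigenWedge {n : ℕ} (ω' : Module.Basis ι K V)
    (e' : Module.Basis (ι × (K ≃ₐ[F₀] K)) K (K ⊗[F₀] V))
    (Φ' : K ⊗[F₀] ⋀[F₀]^n V ≃ₗ[K] ⋀[K]^n (K ⊗[F₀] V))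
    (he2' : ∀ (x : K ≃ₐ[F₀] K) (i : ι) (b : ι → K),
      LinearMap.lTensor K ((ω'.constr K fun i => b i • ω' i).restrictScalars F₀) (e' (i, x)) =
        x (b i) • e' (i, x))
    (hΦ' : ∀ (c : K) (w : Fin n → V),
      Φ' (c ⊗ₜ[F₀] exteriorPower.ιMulti F₀ n w) = c • exteriorPower.ιMulti K n (fun i => (1 : K) ⊗ₜ[F₀] w i)) :
    (Submodule.span F₀ {w : ⋀[F₀]^n V | ∃ (c : Fin n → K) (e : Fin n → ι), Function.Bijective e ∧
        w = exteriorPower.ιMulti F₀ n (fun t => c t • ω' (e t))}).baseChange K =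
      Submodule.span K {z : K ⊗[F₀] ⋀[F₀]^n V | ∃ (f : Fin n → ι) (χ : ι → (K ≃ₐ[F₀] K)),
        Function.Bijective f ∧ z = Φ'.symm (exteriorPower.ιMulti K n (fun t => e' (f t, χ (f t))))} := by
  refine le_antisymm (baseChange_kunneth_le_span_eigenWedge ω' e' Φ' he2' hΦ') ?_
  rw [Submodule.span_le]
  rintro _ ⟨f, χ, hf, rfl⟩
  exact symm_ιMulti_eigen_mem_baseChange_kunneth ω' e' Φ' he2' hΦ' f hf χ

omit [DecidableEq ι] in
/-- **«`a_1 ⊗ ⋯ ⊗ a_{2p}` acts on `K_χ` by `∏_i χ_i(a_i)`»**: `⋀ⁿ(1 ⊗ A′ b)` multiplies the `χ`-line wedge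
`∧_t e′(f t, χ (f t))` by `∏_i χ i (b i)` (`exteriorPower.map_apply_ιMulti`, the eigen-relation slot by slot,
`AlternatingMap.map_smul_univ`, and the bijective re-indexing `∏_t χ (f t) (b (f t)) = ∏_i χ i (b i)`). -/
theorem map_baseChange_diag_ιMulti_eigen [Fintype ι] {n : ℕ} (ω' : Module.Basis ι K V)
    (e' : Module.Basis (ι × (K ≃ₐ[F₀] K)) K (K ⊗[F₀] V))
    (he2' : ∀ (x : K ≃ₐ[F₀] K) (i : ι) (b : ι → K),
      LinearMap.lTensor K ((ω'.constr K fun i => b i • ω' i).restrictScalars F₀) (e' (i, x)) =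
        x (b i) • e' (i, x))
    (b : ι → K) (f : Fin n → ι) (hf : Function.Bijective f) (χ : ι → (K ≃ₐ[F₀] K)) :
    exteriorPower.map n (LinearMap.baseChange K ((ω'.constr K fun i => b i • ω' i).restrictScalars F₀))
        (exteriorPower.ιMulti K n (fun t => e' (f t, χ (f t)))) =
      (∏ i, χ i (b i)) • exteriorPower.ιMulti K n (fun t => e' (f t, χ (f t))) := by
  rw [exteriorPower.map_apply_ιMulti]
  have hslot : (LinearMap.baseChange K ((ω'.constr K fun i => b i • ω' i).restrictScalars F₀) ∘
      fun t => e' (f t, χ (f t))) = fun t => χ (f t) (b (f t)) • e' (f t, χ (f t)) := by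
    funext t
    rw [Function.comp_apply, LinearMap.baseChange_eq_ltensor]
    exact he2' (χ (f t)) (f t) b
  rw [hslot, AlternatingMap.map_smul_univ, hf.prod_comp (fun i => χ i (b i))]

end EigenWedge

/-! ### §2 The decomposition in the wedge basis `E′`, and the Weil line inside it -/

section Graph

variable {F₀ K : Type*} [Field F₀] [Field K] [Algebra F₀ K]
variable {V : Type*} [AddCommGroup V] [Module K V] [Module F₀ V] [IsScalarTower F₀ K V]
variable {ι : Type*} [Fintype ι] [DecidableEq ι] [DecidableEq (K ≃ₐ[F₀] K)]

/-- The increasing enumeration of an `n`-set `L` has image `L`. -/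
theorem image_univ_ofFinEmbEquiv_symm {I : Type*} [LinearOrder I] [DecidableEq I] {n : ℕ}
    (L : Set.powersetCard I n) :
    univ.image (Set.powersetCard.ofFinEmbEquiv.symm L) = (L : Finset I) := by
  ext p
  rw [mem_image]
  constructor
  · rintro ⟨t, -, rfl⟩
    exact (Set.powersetCard.mem_range_ofFinEmbEquiv_symm_iff_mem L _).mp ⟨t, rfl⟩
  · intro hp
    obtain ⟨t, ht⟩ := (Set.powersetCard.mem_range_ofFinEmbEquiv_symm_iff_mem L p).mpr hp
    exact ⟨t, mem_univ t, ht⟩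

/-- **§4(a) in the wedge basis `E′`** (`Φ′ E′_L = ∧ e′(enum L)`): `K_{Künneth} ⊗ K` is the `K`-span of the basis vectors
`E′_L` over the GRAPHS `L = {(i, χ i) : i ∈ ι}` of the characters `χ : ι → Gal` — so the sum `⊕_χ K_χ` is direct, the
`E′_L` being part of a basis.  A graph enumerates the corners bijectively (`≥`: `symm_ιMulti_eigen_mem_baseChange_kunneth`);
a `χ`-line wedge in the enumeration `f` is `± E′_L` for the graph `L` of `χ` (`≤`: `exists_perm_eq_comp_of_image_eq` +
`AlternatingMap.map_perm`). -/
theorem baseChange_kunneth_eq_span_graph {n : ℕ} (hn : Fintype.card ι = n) (ω' : Module.Basis ι K V)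
    [LinearOrder (ι × (K ≃ₐ[F₀] K))]
    (e' : Module.Basis (ι × (K ≃ₐ[F₀] K)) K (K ⊗[F₀] V))
    (E' : Module.Basis (Set.powersetCard (ι × (K ≃ₐ[F₀] K)) n) K (K ⊗[F₀] ⋀[F₀]^n V))
    (Φ' : K ⊗[F₀] ⋀[F₀]^n V ≃ₗ[K] ⋀[K]^n (K ⊗[F₀] V))
    (he2' : ∀ (x : K ≃ₐ[F₀] K) (i : ι) (b : ι → K),
      LinearMap.lTensor K ((ω'.constr K fun i => b i • ω' i).restrictScalars F₀) (e' (i, x)) =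
        x (b i) • e' (i, x))
    (hΦ' : ∀ (c : K) (w : Fin n → V),
      Φ' (c ⊗ₜ[F₀] exteriorPower.ιMulti F₀ n w) = c • exteriorPower.ιMulti K n (fun i => (1 : K) ⊗ₜ[F₀] w i))
    (hE' : ∀ s, Φ' (E' s) = exteriorPower.ιMulti_family K n e' s) :
    (Submodule.span F₀ {w : ⋀[F₀]^n V | ∃ (c : Fin n → K) (e : Fin n → ι), Function.Bijective e ∧
        w = exteriorPower.ιMulti F₀ n (fun t => c t • ω' (e t))}).baseChange K =
      Submodule.span K (E' '' {L | ∃ χ : ι → (K ≃ₐ[F₀] K),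
        (L : Finset (ι × (K ≃ₐ[F₀] K))) = univ.image (fun i => (i, χ i))}) := by
  classical
  refine le_antisymm ?_ ?_
  · -- `≤`: a `χ`-line wedge in the enumeration `f` is `± E′_L`, `L` the graph of `χ`
    rw [baseChange_kunneth_eq_span_eigenWedge ω' e' Φ' he2' hΦ', Submodule.span_le]
    rintro _ ⟨f, χ, hf, rfl⟩
    set s : Fin n → ι × (K ≃ₐ[F₀] K) := fun t => (f t, χ (f t)) with hs
    have hsinj : Function.Injective s := fun t₁ t₂ h => hf.injective (congrArg Prod.fst h)
    have hcard : (univ.image s).card = n := by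
      rw [card_image_of_injective _ hsinj, card_univ, Fintype.card_fin]
    set L : Set.powersetCard (ι × (K ≃ₐ[F₀] K)) n := ⟨univ.image s, Set.powersetCard.mem_iff.mpr hcard⟩ with hL
    have hLgraph : (L : Finset (ι × (K ≃ₐ[F₀] K))) = univ.image (fun i => (i, χ i)) := by
      show univ.image s = _
      have : s = (fun i => (i, χ i)) ∘ f := by funext t; rfl
      rw [this, ← image_image, image_univ_of_surjective hf.surjective]
    -- the increasing enumeration of `L` and `s` differ by a permutation
    set enum : Fin n ↪o (ι × (K ≃ₐ[F₀] K)) := Set.powersetCard.ofFinEmbEquiv.symm L with henum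
    have himg : univ.image enum = univ.image s := by
      rw [henum, image_univ_ofFinEmbEquiv_symm]
    obtain ⟨π, hπ⟩ := exists_perm_eq_comp_of_image_eq enum.injective hsinj himg
    have hEL : Φ'.symm (exteriorPower.ιMulti K n (fun t => e' (s t))) =
        ((Equiv.Perm.sign π : ℤ)) • E' L := by
      have h1 : (fun t => e' (s t)) = (e' ∘ enum) ∘ π := by
        funext t
        rw [Function.comp_apply, Function.comp_apply]
        exact congrArg e' (congrFun hπ t)
      rw [h1, AlternatingMap.map_perm, Units.smul_def, map_zsmul]
      congr 1
      rw [← LinearEquiv.symm_apply_apply Φ' (E' L), hE']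
      rfl
    rw [SetLike.mem_coe, hEL]
    exact Submodule.smul_of_tower_mem _ _ (Submodule.subset_span ⟨L, ⟨χ, hLgraph⟩, rfl⟩)
  · -- `≥`: a graph enumerates the corners bijectively
    rw [Submodule.span_le]
    rintro _ ⟨L, ⟨χ, hL⟩, rfl⟩
    set enum : Fin n ↪o (ι × (K ≃ₐ[F₀] K)) := Set.powersetCard.ofFinEmbEquiv.symm L with henum
    set f : Fin n → ι := fun t => (enum t).1 with hf
    have hsnd : ∀ t, (enum t).2 = χ (f t) := by
      intro t
      have hmem : enum t ∈ (L : Finset (ι × (K ≃ₐ[F₀] K))) :=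
        (Set.powersetCard.mem_range_ofFinEmbEquiv_symm_iff_mem L _).mp ⟨t, rfl⟩
      rw [hL, mem_image] at hmem
      obtain ⟨i, -, hi⟩ := hmem
      show (enum t).2 = χ (enum t).1
      rw [← hi]
    have hpair : ∀ t, enum t = (f t, χ (f t)) := fun t => Prod.ext rfl (hsnd t)
    have hfinj : Function.Injective f := by
      intro t₁ t₂ h
      apply enum.injective
      rw [hpair t₁, hpair t₂, h]
    have hfbij : Function.Bijective f :=
      (Fintype.bijective_iff_injective_and_card f).mpr ⟨hfinj, by rw [Fintype.card_fin, hn]⟩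
    have hEL : E' L = Φ'.symm (exteriorPower.ιMulti K n (fun t => e' (f t, χ (f t)))) := by
      rw [← LinearEquiv.symm_apply_apply Φ' (E' L), hE']
      congr 1
      show exteriorPower.ιMulti K n (e' ∘ enum) = _
      congr 1
      funext t
      rw [Function.comp_apply, hpair t]
    rw [SetLike.mem_coe, hEL]
    exact symm_ιMulti_eigen_mem_baseChange_kunneth ω' e' Φ' he2' hΦ' f hfbij χ

/-- **§4(b)'s «`W_F(B) ⊗ ℂ = ⊕_σ K_{(σ,…,σ)} ⊂ K ⊗ ℂ`» by statement**: the lines `L_σ = {(i, σ)}` are the graphs of the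
constant characters, so `W_F ⊗ K = span{E′_{L_σ}} ≤ K_{Künneth} ⊗ K` (the base-changed form of
`Tier3WeilLineKunneth.weil_line_le_kunneth`, read off the decomposition). -/
theorem weil_line_baseChange_le_baseChange_kunneth {n : ℕ} (hn : Fintype.card ι = n) (ω' : Module.Basis ι K V)
    [LinearOrder (ι × (K ≃ₐ[F₀] K))]
    (e' : Module.Basis (ι × (K ≃ₐ[F₀] K)) K (K ⊗[F₀] V))
    (E' : Module.Basis (Set.powersetCard (ι × (K ≃ₐ[F₀] K)) n) K (K ⊗[F₀] ⋀[F₀]^n V))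
    (Φ' : K ⊗[F₀] ⋀[F₀]^n V ≃ₗ[K] ⋀[K]^n (K ⊗[F₀] V))
    (he2' : ∀ (x : K ≃ₐ[F₀] K) (i : ι) (b : ι → K),
      LinearMap.lTensor K ((ω'.constr K fun i => b i • ω' i).restrictScalars F₀) (e' (i, x)) =
        x (b i) • e' (i, x))
    (hΦ' : ∀ (c : K) (w : Fin n → V),
      Φ' (c ⊗ₜ[F₀] exteriorPower.ιMulti F₀ n w) = c • exteriorPower.ιMulti K n (fun i => (1 : K) ⊗ₜ[F₀] w i))
    (hE' : ∀ s, Φ' (E' s) = exteriorPower.ιMulti_family K n e' s)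
    (WF : Submodule F₀ (⋀[F₀]^n V))
    (hWF : WF.baseChange K =
      Submodule.span K (E' '' {L | ∃ σ : K ≃ₐ[F₀] K, (L : Finset (ι × (K ≃ₐ[F₀] K))) = lineSet σ})) :
    WF.baseChange K ≤
      (Submodule.span F₀ {w : ⋀[F₀]^n V | ∃ (c : Fin n → K) (e : Fin n → ι), Function.Bijective e ∧
        w = exteriorPower.ιMulti F₀ n (fun t => c t • ω' (e t))}).baseChange K := by
  rw [hWF, baseChange_kunneth_eq_span_graph hn ω' e' E' Φ' he2' hΦ' hE']
  refine Submodule.span_mono (Set.image_mono ?_)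
  rintro L ⟨σ, hL⟩
  exact ⟨fun _ => σ, hL⟩

end Graph

end HodgeRepro.Tier3
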